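import Mathlib.Analysis.SpecificLimits.Basic
import Mathlib.Analysis.SpecialFunctions.Pow.Real
import Mathlib.RingTheory.RootsOfUnity.Complex
import Literature.Computability.AlgebraicComplexity.AsymptoticRankZariskiClosedProofs
import Summits.MatrixMultiplication.MatrixMultiplication.Theses.HessianPlane
import HarnessLib

/-!
# Route HessianPlane — the split `RegularConstancy → RegularFlatPoint → HessianPlaneFlat`

Route `HessianPlane` of `MatrixMultiplication`, deciding crux stmt-MatrixMultiplication-4891
(`HessianPlaneFlat`: for all `(a,b,c) ∈ ℂ³`, `R(u(a,b,c)^{⊠N}) = O(3^{(1+ε)N})`, i.e. asymptotic rank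
`≤ 3` on the whole Hessian plane `u(a,b,c)(x,y,z) = [x+y+z ≡ 0]·![a,b,c](y−x)`).

BC2-redirect decomposition (crux-strategist, 2026-08-17). Let
`P(a,b,c) = abc · (a³−b³)(b³−c³)(c³−a³) · ((a³+b³+c³)³ − 27a³b³c³)`, the defining polynomial of the
21 lines of the reflection arrangement of the group `G₂₆ ⊃ W = G₂₅` acting on the plane: the 12
mirrors `abc · ∏_{i,j}(a + ωⁱb + ωʲc) = 0` of `G₂₅` (hyperdeterminant `Δ = 0`; they carry the
Coppersmith–Winograd orbit `W·(0,1,1)` and the Levi-Civita orbit `W·(0,1,−1)`) and the 9 lines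
`a³ = b³, b³ = c³, c³ = a³` (`I₉ = 0`, border rank `≤ 4`). Its complement `U = {P ≠ 0}` is the
REGULAR set: border rank `5`, `Δ ≠ 0`, no summit point, no unit point.

* piece 1 `RegularConstancy`: `R̃ ∘ u` is constant on `U`;
* piece 2 `RegularFlatPoint`: some point of `U` has `R̃(u) ≤ 3`;
* this file: `hessianPlaneFlat_of_subs : RegularConstancy → RegularFlatPoint → HessianPlaneFlat`
  (statements inlined; the route decls are generated by `ledger route edit --split`).

Proof. (1) The two pieces give `R̃(u(w)) ≤ 3` on `U`. (2) `U` is dense: with a primitive cube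
root of unity `ω` the polynomial `P` is the product of 21 linear forms
(`a³ − b³ = (a−b)(a−ωb)(a−ω²b)`, `(a³+b³+c³)³ − 27a³b³c³ = ∏_{i,j}(a+ωⁱb+ωʲc)`), none of which
vanishes at `v = (1,2,4)`, so along `w + v/(n+1)` each form vanishes for at most one `n` and
`w + v/(n+1) ∈ U` eventually. (3) By Christandl–Hoeberechts–Nieuwboer–Vrana–Zuiddam, Thm 1.2
(PROVED in tree: `chnvz_zariskiClosed_asymptoticRank_le_holds`, Euclidean form `.isClosed_complex`)
the sublevel set `{t : R̃(t) ≤ 3}` is closed, and `w ↦ u(w)` is continuous, so `R̃(u(w)) ≤ 3` for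
every `w ∈ ℂ³`. (4) `R̃(t) ≤ 3 < 3^{1+ε}` gives `R(t^{⊠N}) ≤ C·3^{(1+ε)N}` for all `N`
(`exists_const_tensorRank_kroneckerPow_le`, the growth form of the infimum), i.e. the route's
`=O[atTop]` statement.

## References

* M. Christandl, K. Hoeberechts, H. Nieuwboer, P. Vrana, J. Zuiddam, *Asymptotic tensor rank is
  characterized by polynomials*, STOC 2025 = arXiv:2411.15789, Thm 1.2.
  [ChristandlHoeberechtsNieuwboerVranaZuiddam2025]
* M. R. Bremner, J. Hu, L. Oeding, *The 3 × 3 × 3 hyperdeterminant as a polynomial in the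
  fundamental invariants for SL₃(ℂ)×SL₃(ℂ)×SL₃(ℂ)*, arXiv:1310.3257, §4 (normal form, `Δ|𝔠`).
  [BremnerHuOeding2014]
* G. C. Shephard, J. A. Todd, *Finite unitary reflection groups*, Canad. J. Math. 6 (1954)
  (G₂₅, G₂₆ and their 12 resp. 21 mirrors). [ShephardTodd1954]
-/

-- the tree's namespace `Summit.MatrixMultiplication.MatrixMultiplication.…` repeats a component by design
set_option linter.dupNamespace false

noncomputable section

namespace Summit.MatrixMultiplication.MatrixMultiplication.Theorems

open Literature.Computability.AlgebraicComplexity Filter Topology Asymptotics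

/-- The weighted `ℤ/3` addition table `u(a,b,c)` of the Hessian plane (route notation, verbatim). -/
local notation3 "𝑢[" a ", " b ", " c "]" =>
  (fun x y z : Fin 3 => if x + y + z = 0 then ![a, b, c] (y - x) else (0 : ℂ))

/-- The defining polynomial `P(a,b,c)` of the 21-line arrangement (route notation, verbatim). -/
local notation3 "𝒫[" a ", " b ", " c "]" =>
  (a * b * c * (a ^ 3 - b ^ 3) * (b ^ 3 - c ^ 3) * (c ^ 3 - a ^ 3) *
    ((a ^ 3 + b ^ 3 + c ^ 3) ^ 3 - 27 * a ^ 3 * b ^ 3 * c ^ 3))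

/-- The perturbation parameter `δₙ = 1/(n+1)` (real, cast to `ℂ` where used). -/
local notation3 "δ[" n "]" => (((1 : ℝ) / ((n : ℝ) + 1) : ℝ) : ℂ)

/-! ## 1. From `R̃ ≤ 3` to the growth form -/

/-- `R̃(t) ≤ 3` implies `R(t^{⊠N}) = O(3^{(1+ε)N})` for every `ε > 0`: since `3 < 3^{1+ε}`, the
infimum defining `R̃` is beaten by some power and submultiplicativity propagates
(`exists_const_tensorRank_kroneckerPow_le`). [folklore] -/
theorem isBigO_of_asymptoticRank_le_three {t : Fin 3 → Fin 3 → Fin 3 → ℂ}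
    (ht : asymptoticRank t ≤ 3) {ε : ℝ} (hε : 0 < ε) :
    (fun N : ℕ => (tensorRank (kroneckerPow t N) : ℝ)) =O[atTop]
      fun N : ℕ => (3 : ℝ) ^ ((1 + ε) * N) := by
  have h3 : (3 : ℝ) < (3 : ℝ) ^ (1 + ε) := by
    have h := (Real.rpow_lt_rpow_left_iff (show (1 : ℝ) < 3 by norm_num)).2
      (show (1 : ℝ) < 1 + ε by linarith)
    rwa [Real.rpow_one] at h
  obtain ⟨C, -, hC⟩ := exists_const_tensorRank_kroneckerPow_le t (by positivity) (ht.trans_lt h3)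
  refine IsBigO.of_bound C ?_
  filter_upwards with N
  rw [Real.norm_of_nonneg (Nat.cast_nonneg _), Real.norm_of_nonneg (by positivity)]
  calc (tensorRank (kroneckerPow t N) : ℝ) ≤ C * ((3 : ℝ) ^ (1 + ε)) ^ N := hC N
    _ = C * (3 : ℝ) ^ ((1 + ε) * N) := by
        rw [← Real.rpow_natCast ((3 : ℝ) ^ (1 + ε)) N, ← Real.rpow_mul (by norm_num)]

/-! ## 2. A primitive cube root of unity and the 21 linear factors of `P` -/

/-- There is `ω ∈ ℂ` with `ω² + ω + 1 = 0` (e.g. `exp(2πi/3)`). [folklore] -/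
theorem exists_omega : ∃ ω : ℂ, ω ^ 2 + ω + 1 = 0 := by
  refine ⟨Complex.exp (2 * Real.pi * Complex.I / (3 : ℕ)), ?_⟩
  have h := (Complex.isPrimitiveRoot_exp 3 (by norm_num)).geom_sum_eq_zero (by norm_num)
  simp only [Finset.sum_range_succ, Finset.sum_range_zero, pow_zero, pow_one, zero_add] at h
  linear_combination h

section Omega

variable {ω : ℂ} (hω : ω ^ 2 + ω + 1 = 0)
include hω

/-- `x³ − y³ = (x − y)(x − ωy)(x − ω²y)`. [folklore] -/
theorem cube_sub_cube (x y : ℂ) : x ^ 3 - y ^ 3 = (x - y) * (x - ω * y) * (x - ω ^ 2 * y) := by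
  linear_combination (x - y) * (x * y - (ω - 1) * y ^ 2) * hω

/-- `(x + c)(x + ωc)(x + ω²c) = x³ + c³`. [folklore] -/
theorem add_cube_factor (x c : ℂ) : (x + c) * (x + ω * c) * (x + ω ^ 2 * c) = x ^ 3 + c ^ 3 := by
  linear_combination (x + c) * (x * c + (ω - 1) * c ^ 2) * hω

/-- The norm form of `ℚ(ω)`: `(s+p+q)(s+ωp+ω²q)(s+ω²p+ωq) = s³+p³+q³−3spq`. [folklore] -/
theorem norm_form (s p q : ℂ) :
    (s + p + q) * (s + ω * p + ω ^ 2 * q) * (s + ω ^ 2 * p + ω * q) =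
      s ^ 3 + p ^ 3 + q ^ 3 - 3 * s * p * q := by
  have key : (s + ω * p + ω ^ 2 * q) * (s + ω ^ 2 * p + ω * q) =
      s ^ 2 + p ^ 2 + q ^ 2 - s * p - s * q - p * q := by
    linear_combination (s * (p + q) + (ω - 1) * (p ^ 2 + q ^ 2) + (ω ^ 2 - ω + 1) * p * q) * hω
  rw [mul_assoc, key]
  ring

/-- `(a + ωb)³ + c³` in the coordinates `S = a³+b³+c³, P = 3a²b, Q = 3ab²`. [folklore] -/
theorem cube_add_omega_one (a b c : ℂ) : (a + ω * b) ^ 3 + c ^ 3 =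
    (a ^ 3 + b ^ 3 + c ^ 3) + ω * (3 * a ^ 2 * b) + ω ^ 2 * (3 * a * b ^ 2) := by
  linear_combination (ω - 1) * b ^ 3 * hω

/-- `(a + ω²b)³ + c³` in the coordinates `S, P, Q`. [folklore] -/
theorem cube_add_omega_two (a b c : ℂ) : (a + ω ^ 2 * b) ^ 3 + c ^ 3 =
    (a ^ 3 + b ^ 3 + c ^ 3) + ω ^ 2 * (3 * a ^ 2 * b) + ω * (3 * a * b ^ 2) := by
  linear_combination (3 * ω * (ω - 1) * a * b ^ 2 + (ω - 1) * (ω ^ 3 + 1) * b ^ 3) * hω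

/-- The twelve non-coordinate mirrors: `(a³+b³+c³)³ − 27a³b³c³ = ∏_{i,j ∈ ℤ/3} (a + ωⁱb + ωʲc)`
(Bremner–Hu–Oeding 2014, §4: the restriction of the hyperdeterminant to the plane is
`−4a³b³c³ ∏_{i,j}(a+ωⁱb+ωʲc)³`). [folklore] -/
theorem c9_factor (a b c : ℂ) :
    (a ^ 3 + b ^ 3 + c ^ 3) ^ 3 - 27 * a ^ 3 * b ^ 3 * c ^ 3 =
      ((a + b + c) * (a + b + ω * c) * (a + b + ω ^ 2 * c)) *
      (((a + ω * b + c) * (a + ω * b + ω * c) * (a + ω * b + ω ^ 2 * c)) *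
      ((a + ω ^ 2 * b + c) * (a + ω ^ 2 * b + ω * c) * (a + ω ^ 2 * b + ω ^ 2 * c))) := by
  rw [add_cube_factor hω (a + b) c, add_cube_factor hω (a + ω * b) c,
    add_cube_factor hω (a + ω ^ 2 * b) c, cube_add_omega_one hω, cube_add_omega_two hω]
  have h0 : (a + b) ^ 3 + c ^ 3 = (a ^ 3 + b ^ 3 + c ^ 3) + 3 * a ^ 2 * b + 3 * a * b ^ 2 := by
    ring
  rw [h0, ← mul_assoc, norm_form hω]
  ring

/-- If the 21 linear forms of the arrangement do not vanish at `(a,b,c)`, then `P(a,b,c) ≠ 0`.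
[folklore] -/
theorem arrangement_ne_zero {a b c : ℂ}
    (h₁ : a ≠ 0) (h₂ : b ≠ 0) (h₃ : c ≠ 0)
    (h₄ : a - b ≠ 0) (h₅ : a - ω * b ≠ 0) (h₆ : a - ω ^ 2 * b ≠ 0)
    (h₇ : b - c ≠ 0) (h₈ : b - ω * c ≠ 0) (h₉ : b - ω ^ 2 * c ≠ 0)
    (h₁₀ : c - a ≠ 0) (h₁₁ : c - ω * a ≠ 0) (h₁₂ : c - ω ^ 2 * a ≠ 0)
    (h₁₃ : a + b + c ≠ 0) (h₁₄ : a + b + ω * c ≠ 0) (h₁₅ : a + b + ω ^ 2 * c ≠ 0)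
    (h₁₆ : a + ω * b + c ≠ 0) (h₁₇ : a + ω * b + ω * c ≠ 0) (h₁₈ : a + ω * b + ω ^ 2 * c ≠ 0)
    (h₁₉ : a + ω ^ 2 * b + c ≠ 0) (h₂₀ : a + ω ^ 2 * b + ω * c ≠ 0)
    (h₂₁ : a + ω ^ 2 * b + ω ^ 2 * c ≠ 0) :
    𝒫[a, b, c] ≠ 0 := by
  rw [cube_sub_cube hω a b, cube_sub_cube hω b c, cube_sub_cube hω c a, c9_factor hω a b c]
  repeat' refine mul_ne_zero ?_ ?_
  all_goals assumption

end Omega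

/-- No real number is a primitive cube root of unity: a `ℝ`-linear expression `α + βω` with
`(α, β) ≠ (0, 0)` is nonzero. [folklore] -/
theorem omega_lin_ne_zero {ω : ℂ} (hω : ω ^ 2 + ω + 1 = 0) {z : ℂ} (α β : ℝ)
    (hz : z = α + β * ω) (h : α ≠ 0 ∨ β ≠ 0) : z ≠ 0 := by
  rintro rfl
  rcases eq_or_ne β 0 with hb | hb
  · subst hb
    have hα : (α : ℂ) = 0 := by simpa using hz.symm
    rcases h with h | h
    · exact h (by exact_mod_cast hα)
    · exact h rfl
  · have hb' : (β : ℂ) ≠ 0 := by exact_mod_cast hb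
    have hωr : ω = ((-α / β : ℝ) : ℂ) := by
      rw [Complex.ofReal_div, Complex.ofReal_neg, eq_div_iff hb']
      linear_combination -hz
    rw [hωr] at hω
    have hreal : (-α / β) ^ 2 + (-α / β) + 1 = (0 : ℝ) := by exact_mod_cast hω
    nlinarith [sq_nonneg (-α / β + 1 / 2)]

/-! ## 3. Density of the regular set along `w + (1,2,4)/(n+1)` -/

/-- `n ↦ 1/(n+1)` is injective. [folklore] -/
theorem pert_injective : Function.Injective fun n : ℕ => (1 : ℝ) / ((n : ℝ) + 1) := by
  intro n m h
  simp only [one_div, inv_inj] at h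
  exact_mod_cast (add_right_cancel h : (n : ℝ) = m)

/-- Along the sequence, an affine-linear expression `z + δₙ L` with `L ≠ 0` vanishes for at most one
`n`, hence is eventually nonzero. [folklore] -/
theorem eventually_lin_ne_zero (z L : ℂ) (hL : L ≠ 0) :
    ∀ᶠ n : ℕ in atTop, z + δ[n] * L ≠ 0 := by
  rw [eventually_atTop]
  by_cases h : ∃ n : ℕ, z + δ[n] * L = 0
  · obtain ⟨n₀, hn₀⟩ := h
    refine ⟨n₀ + 1, fun n hn heq => ?_⟩
    have h1 : δ[n] * L = δ[n₀] * L := by linear_combination heq - hn₀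
    have h2 : δ[n] = δ[n₀] := mul_right_cancel₀ hL h1
    have h3 : (1 : ℝ) / ((n : ℝ) + 1) = 1 / ((n₀ : ℝ) + 1) := by exact_mod_cast h2
    have h4 : n = n₀ := pert_injective h3
    omega
  · exact ⟨0, fun n _ => fun h0 => h ⟨n, h0⟩⟩

/-- **Density of the regular set.** For every `(a,b,c)`, the points `(a,b,c) + (1,2,4)/(n+1)` lie off
all 21 lines for all large `n`. [folklore] -/
theorem eventually_arrangement_ne_zero (a b c : ℂ) :
    ∀ᶠ n : ℕ in atTop, 𝒫[a + δ[n], b + 2 * δ[n], c + 4 * δ[n]] ≠ 0 := by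
  obtain ⟨ω, hω⟩ := exists_omega
  have E := fun (z L : ℂ) (hL : L ≠ 0) => eventually_lin_ne_zero z L hL
  have N := fun (z : ℂ) (α β : ℝ) (hz : z = α + β * ω) (h : α ≠ 0 ∨ β ≠ 0) =>
    omega_lin_ne_zero hω α β hz h
  filter_upwards [E a 1 one_ne_zero, E b 2 two_ne_zero, E c 4 (by norm_num),
    E (a - b) (-1) (by norm_num),
    E (a - ω * b) (1 - 2 * ω) (N _ 1 (-2) (by push_cast; ring) (by norm_num)),
    E (a - ω ^ 2 * b) (1 - 2 * ω ^ 2)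
      (N _ 3 2 (by push_cast; linear_combination (-2 : ℂ) * hω) (by norm_num)),
    E (b - c) (-2) (by norm_num),
    E (b - ω * c) (2 - 4 * ω) (N _ 2 (-4) (by push_cast; ring) (by norm_num)),
    E (b - ω ^ 2 * c) (2 - 4 * ω ^ 2)
      (N _ 6 4 (by push_cast; linear_combination (-4 : ℂ) * hω) (by norm_num)),
    E (c - a) 3 (by norm_num),
    E (c - ω * a) (4 - ω) (N _ 4 (-1) (by push_cast; ring) (by norm_num)),
    E (c - ω ^ 2 * a) (4 - ω ^ 2)
      (N _ 5 1 (by push_cast; linear_combination (-1 : ℂ) * hω) (by norm_num)),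
    E (a + b + c) 7 (by norm_num),
    E (a + b + ω * c) (3 + 4 * ω) (N _ 3 4 (by push_cast; ring) (by norm_num)),
    E (a + b + ω ^ 2 * c) (3 + 4 * ω ^ 2)
      (N _ (-1) (-4) (by push_cast; linear_combination (4 : ℂ) * hω) (by norm_num)),
    E (a + ω * b + c) (5 + 2 * ω) (N _ 5 2 (by push_cast; ring) (by norm_num)),
    E (a + ω * b + ω * c) (1 + 6 * ω) (N _ 1 6 (by push_cast; ring) (by norm_num)),
    E (a + ω * b + ω ^ 2 * c) (1 + 2 * ω + 4 * ω ^ 2)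
      (N _ (-3) (-2) (by push_cast; linear_combination (4 : ℂ) * hω) (by norm_num)),
    E (a + ω ^ 2 * b + c) (5 + 2 * ω ^ 2)
      (N _ 3 (-2) (by push_cast; linear_combination (2 : ℂ) * hω) (by norm_num)),
    E (a + ω ^ 2 * b + ω * c) (1 + 2 * ω ^ 2 + 4 * ω)
      (N _ (-1) 2 (by push_cast; linear_combination (2 : ℂ) * hω) (by norm_num)),
    E (a + ω ^ 2 * b + ω ^ 2 * c) (1 + 6 * ω ^ 2)
      (N _ (-5) (-6) (by push_cast; linear_combination (6 : ℂ) * hω) (by norm_num))]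
    with n g₁ g₂ g₃ g₄ g₅ g₆ g₇ g₈ g₉ g₁₀ g₁₁ g₁₂ g₁₃ g₁₄ g₁₅ g₁₆ g₁₇ g₁₈ g₁₉ g₂₀ g₂₁
  refine arrangement_ne_zero hω ?_ ?_ ?_ ?_ ?_ ?_ ?_ ?_ ?_ ?_ ?_ ?_ ?_ ?_ ?_ ?_ ?_ ?_ ?_ ?_ ?_
  · exact fun h0 => g₁ (by linear_combination h0)
  · exact fun h0 => g₂ (by linear_combination h0)
  · exact fun h0 => g₃ (by linear_combination h0)
  · exact fun h0 => g₄ (by linear_combination h0)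
  · exact fun h0 => g₅ (by linear_combination h0)
  · exact fun h0 => g₆ (by linear_combination h0)
  · exact fun h0 => g₇ (by linear_combination h0)
  · exact fun h0 => g₈ (by linear_combination h0)
  · exact fun h0 => g₉ (by linear_combination h0)
  · exact fun h0 => g₁₀ (by linear_combination h0)
  · exact fun h0 => g₁₁ (by linear_combination h0)
  · exact fun h0 => g₁₂ (by linear_combination h0)
  · exact fun h0 => g₁₃ (by linear_combination h0)
  · exact fun h0 => g₁₄ (by linear_combination h0)
  · exact fun h0 => g₁₅ (by linear_combination h0)
  · exact fun h0 => g₁₆ (by linear_combination h0)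
  · exact fun h0 => g₁₇ (by linear_combination h0)
  · exact fun h0 => g₁₈ (by linear_combination h0)
  · exact fun h0 => g₁₉ (by linear_combination h0)
  · exact fun h0 => g₂₀ (by linear_combination h0)
  · exact fun h0 => g₂₁ (by linear_combination h0)

/-! ## 4. Closedness of `{R̃ ≤ 3}` (CHNVZ) and the passage to the limit -/

/-- The perturbed tables converge to `u(a,b,c)` entrywise. [folklore] -/
theorem tendsto_hessTab (a b c : ℂ) :
    Tendsto (fun n : ℕ => 𝑢[a + δ[n], b + 2 * δ[n], c + 4 * δ[n]]) atTop (𝓝 𝑢[a, b, c]) := by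
  have hδ : Tendsto (fun n : ℕ => δ[n]) atTop (𝓝 0) := by
    have h := (Complex.continuous_ofReal.tendsto 0).comp tendsto_one_div_add_atTop_nhds_zero_nat
    simp only [Function.comp_def, Complex.ofReal_zero] at h
    exact h
  have ha : Tendsto (fun n : ℕ => a + δ[n]) atTop (𝓝 a) := by
    simpa using tendsto_const_nhds.add hδ
  have hb : Tendsto (fun n : ℕ => b + 2 * δ[n]) atTop (𝓝 b) := by
    simpa using tendsto_const_nhds.add (hδ.const_mul (2 : ℂ))
  have hc : Tendsto (fun n : ℕ => c + 4 * δ[n]) atTop (𝓝 c) := by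
    simpa using tendsto_const_nhds.add (hδ.const_mul (4 : ℂ))
  have key : ∀ k : Fin 3,
      Tendsto (fun n : ℕ => ![a + δ[n], b + 2 * δ[n], c + 4 * δ[n]] k) atTop (𝓝 (![a, b, c] k)) := by
    intro k
    fin_cases k
    · simpa using ha
    · simpa using hb
    · simpa using hc
  refine tendsto_pi_nhds.2 fun x => tendsto_pi_nhds.2 fun y => tendsto_pi_nhds.2 fun z => ?_
  by_cases hxyz : x + y + z = 0
  · simpa [hxyz] using key (y - x)
  · simp [hxyz]

/-- **Closedness transfer.** If `R̃(u) ≤ 3` at every regular point, then `R̃(u) ≤ 3` at every point of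
the plane: the sublevel set `{t : R̃(t) ≤ 3}` is Euclidean-closed (CHNVZ 2025, Thm 1.2, proved in
tree) and the regular points `(a,b,c) + (1,2,4)/(n+1)` converge to `(a,b,c)`.
[cite: ChristandlHoeberechtsNieuwboerVranaZuiddam2025, Theorem 1.2] -/
theorem asymptoticRank_le_three_of_regular
    (hU : ∀ a b c : ℂ, 𝒫[a, b, c] ≠ 0 → asymptoticRank 𝑢[a, b, c] ≤ 3) (a b c : ℂ) :
    asymptoticRank 𝑢[a, b, c] ≤ 3 := by
  have hclosed : IsClosed {t : Fin 3 → Fin 3 → Fin 3 → ℂ | asymptoticRank t ≤ 3} :=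
    chnvz_zariskiClosed_asymptoticRank_le_holds.isClosed_complex 3
  refine hclosed.mem_of_tendsto (tendsto_hessTab a b c) ?_
  filter_upwards [eventually_arrangement_ne_zero a b c] with n hn
  exact hU _ _ _ hn

/-! ## 5. The assembly -/

/-- **Split of the deciding crux** (BC2 redirect): `RegularConstancy → RegularFlatPoint →
HessianPlaneFlat`. Piece 1 says `R̃ ∘ u` is constant on the regular set `U = {P ≠ 0}` of the
21-line arrangement; piece 2 says some point of `U` has `R̃(u) ≤ 3`; hence `R̃(u) ≤ 3` on `U`, on
all of `ℂ³` by closedness + density (`asymptoticRank_le_three_of_regular`), and the growth form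
follows (`isBigO_of_asymptoticRank_le_three`). The hypotheses are the two pieces with their
statements inlined (the route decls `HessianPlane.RegularConstancy` / `HessianPlane.RegularFlatPoint`
unfold to them verbatim). [folklore] -/
theorem hessianPlaneFlat_of_subs
    (h₁ : ∀ a b c a' b' c' : ℂ, a * b * c * (a ^ 3 - b ^ 3) * (b ^ 3 - c ^ 3) * (c ^ 3 - a ^ 3) * ((a ^ 3 + b ^ 3 + c ^ 3) ^ 3 - 27 * a ^ 3 * b ^ 3 * c ^ 3) ≠ 0 → a' * b' * c' * (a' ^ 3 - b' ^ 3) * (b' ^ 3 - c' ^ 3) * (c' ^ 3 - a' ^ 3) * ((a' ^ 3 + b' ^ 3 + c' ^ 3) ^ 3 - 27 * a' ^ 3 * b' ^ 3 * c' ^ 3) ≠ 0 → Literature.Computability.AlgebraicComplexity.asymptoticRank (fun x y z : Fin 3 => if x + y + z = 0 then ![a, b, c] (y - x) else (0 : ℂ)) = Literature.Computability.AlgebraicComplexity.asymptoticRank (fun x y z : Fin 3 => if x + y + z = 0 then ![a', b', c'] (y - x) else (0 : ℂ)))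
    (h₂ : ∃ a b c : ℂ, a * b * c * (a ^ 3 - b ^ 3) * (b ^ 3 - c ^ 3) * (c ^ 3 - a ^ 3) * ((a ^ 3 + b ^ 3 + c ^ 3) ^ 3 - 27 * a ^ 3 * b ^ 3 * c ^ 3) ≠ 0 ∧ Literature.Computability.AlgebraicComplexity.asymptoticRank (fun x y z : Fin 3 => if x + y + z = 0 then ![a, b, c] (y - x) else (0 : ℂ)) ≤ 3) :
    Summit.MatrixMultiplication.MatrixMultiplication.Theses.HessianPlane.HessianPlaneFlat := by
  obtain ⟨a₀, b₀, c₀, hreg₀, hle₀⟩ := h₂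
  have hU : ∀ a b c : ℂ, 𝒫[a, b, c] ≠ 0 → asymptoticRank 𝑢[a, b, c] ≤ 3 :=
    fun a b c h => (h₁ a b c a₀ b₀ c₀ h hreg₀).trans_le hle₀
  intro a b c ε hε
  exact isBigO_of_asymptoticRank_le_three (asymptoticRank_le_three_of_regular hU a b c) hε

end Summit.MatrixMultiplication.MatrixMultiplication.Theorems

end
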